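import Literature.MathematicalPhysics.QuantumFieldTheory.TorusFreeTransfer
import Literature.MathematicalPhysics.QuantumFieldTheory.U1WeakCouplingD4
import Literature.Probability.LatticeModels.GinibreInequality
import HarnessLib

/-!
# Discharge of `GinibreU1TorusGeFreeBoxD4`: torus Wilson loops dominate free-boundary ones

`Literature.MathematicalPhysics.QuantumFieldTheory.GinibreU1TorusGeFreeBoxD4` (vendored in
`U1WeakCouplingD4.lean` as a consequence of Ginibre 1970) states: for `U(1)` lattice gauge
theory with the Wilson action at `β ≥ 0`, the cube `Λ_n = {-n,…,n}⁴` and the torus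
`(ℤ/(L+1)ℤ)⁴` with `2n ≤ L`, every rectangular Wilson loop at the origin with `R, T ≤ n`
(`i ≠ j`) satisfies `⟨W_{R×T}⟩^{free}_{Λ_n,β} ≤ ⟨W_{R×T}⟩_{torus L+1,β}`. This file PROVES it
(`ginibreU1TorusGeFreeBoxD4_holds`) from Ginibre's inequality
`Literature.Probability.LatticeModels.ginibreExpect_reChar_mono`:

1. On the torus configuration group `Ω = U(1)^{E}` (compact abelian, every element a square:
   `exists_mul_self_eq_u1Config`), the plaquette holonomies `U ↦ U_q` and the loop holonomy are continuous
   characters (`u1PlaqChar`, `u1RectChar`), `Re tr u1Rep = Re`, and the torus Wilson weight is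
   `e^{-β|P|} · exp(∑_q β Re U_q)` (`exp_neg_mul_wilsonAction_u1`), so
   `⟨W⟩_{torus} = ginibreExpect μ χ (β·1) (Re χ_γ)` (`wilsonExpectation_u1_eq_ginibreExpect`).
2. The free-boundary cube expectation is a torus Gibbs expectation with the couplings of all
   plaquettes outside the embedded cube switched off (`boxCoupling`, `= β` on images of cube
   plaquettes, `0` elsewhere): the integrands depend only on cube edges, on which the
   periodisation is injective, so the transfer lemma `integral_torusLift_eq_integral_zdHaar`
   applies (`zdExpect_u1_box_eq_ginibreExpect`).
3. `0 ≤ boxCoupling ≤ β`, hence Ginibre's monotonicity gives the comparison.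

Sources: J. Ginibre, Comm. Math. Phys. 16 (1970) 310, Prop. 3 (the inequality
`⟨fg⟩_h ≥ ⟨f⟩_h ⟨g⟩_h` for `f, g, −h` in the cone of a Ginibre class) with Example 4 (the real
parts of the characters of a compact abelian group form such a class), as quoted by
Forsström–Lenells–Viklund, AIHP 2022 (arXiv:2001.07453) Lemma 4.2 and proof of their Thm 4.1,
where exactly this "switch on the couplings of the larger box" monotonicity is used for
Wilson-action abelian lattice gauge theories; for `U(1)` the comparison of boundary conditions
is folklore (Fröhlich–Spencer 1982 as reported by Garban–Sepúlveda 2023 Prop. 2.11).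
-/

noncomputable section

open MeasureTheory Filter Finset
open Literature.Probability.LatticeModels Literature.MathematicalPhysics.QuantumLattice

namespace Literature.MathematicalPhysics.QuantumFieldTheory

open AreaLaw

/-! ### `U(1)` holonomies as continuous characters of the torus configuration group -/

section Characters

variable {d L : ℕ}

/-- `Re tr u1Rep(z) = Re z` (trace of a `1 × 1` matrix). [folklore] -/
theorem trace_u1Rep_re (z : Circle) : (u1Rep z).trace.re = (z : ℂ).re := by
  simp [u1Rep_apply, Matrix.scalar_apply, Matrix.trace]

/-- Straight-path holonomies are multiplicative in the configuration (abelian gauge group).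
[folklore] -/
theorem lineHolonomy_mul (U V : GaugeConfig d L Circle) (k : Fin d) :
    ∀ (n : ℕ) (y : Site d L),
      lineHolonomy (U * V) k n y = lineHolonomy U k n y * lineHolonomy V k n y
  | 0, _ => by simp [lineHolonomy]
  | n + 1, y => by
    rw [lineHolonomy, lineHolonomy, lineHolonomy, lineHolonomy_mul U V k n, Pi.mul_apply]
    exact mul_mul_mul_comm _ _ _ _

/-- Straight-path holonomies of the trivial configuration are trivial. [folklore] -/
theorem lineHolonomy_one (k : Fin d) :
    ∀ (n : ℕ) (y : Site d L), lineHolonomy (1 : GaugeConfig d L Circle) k n y = 1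
  | 0, _ => rfl
  | n + 1, y => by rw [lineHolonomy, lineHolonomy_one k n, Pi.one_apply, one_mul]

/-- Straight-path holonomies are continuous in the configuration. [folklore] -/
theorem continuous_lineHolonomy (k : Fin d) :
    ∀ (n : ℕ) (y : Site d L), Continuous fun U : GaugeConfig d L Circle => lineHolonomy U k n y
  | 0, _ => continuous_const
  | n + 1, _ => (continuous_apply _).mul (continuous_lineHolonomy k n _)

/-- The plaquette holonomy `U ↦ U_p` of `U(1)` configurations on the torus, as a continuous
unitary character of the compact abelian group `U(1)^E`. [folklore] -/
def u1PlaqChar (x : Site d L) (k l : Fin d) : GaugeConfig d L Circle →ₜ* Circle where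
  toFun U := plaquetteHolonomy U x k l
  map_one' := by simp [plaquetteHolonomy]
  map_mul' U V := by
    apply Circle.ext
    simp only [plaquetteHolonomy, Pi.mul_apply, Circle.coe_mul, Circle.coe_inv]
    ring
  continuous_toFun := by unfold plaquetteHolonomy; fun_prop

/-- `u1PlaqChar x k l U = U_{(x;k,l)}`. [folklore] -/
@[simp] theorem u1PlaqChar_apply (x : Site d L) (k l : Fin d) (U : GaugeConfig d L Circle) :
    u1PlaqChar x k l U = plaquetteHolonomy U x k l := rfl

/-- The rectangular Wilson-loop holonomy of `U(1)` configurations on the torus, as a continuous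
unitary character. [folklore] -/
def u1RectChar (x : Site d L) (i j : Fin d) (R T : ℕ) : GaugeConfig d L Circle →ₜ* Circle where
  toFun U := rectangleHolonomy U x i j R T
  map_one' := by simp [rectangleHolonomy, lineHolonomy_one]
  map_mul' U V := by
    apply Circle.ext
    simp only [rectangleHolonomy, lineHolonomy_mul, Circle.coe_mul, Circle.coe_inv]
    ring
  continuous_toFun := by
    unfold rectangleHolonomy
    exact (((continuous_lineHolonomy i R x).mul (continuous_lineHolonomy j T _)).mul
      (continuous_lineHolonomy i R _).inv).mul (continuous_lineHolonomy j T x).inv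

/-- `u1RectChar x i j R T U = hol_{R×T}(U)`. [folklore] -/
@[simp] theorem u1RectChar_apply (x : Site d L) (i j : Fin d) (R T : ℕ) (U : GaugeConfig d L Circle) :
    u1RectChar x i j R T U = rectangleHolonomy U x i j R T := rfl

/-- The torus Wilson loop of `U(1)` is the real part of the loop character. [folklore] -/
theorem wilsonLoop_u1Rep (x : Site d L) (i j : Fin d) (R T : ℕ) (U : GaugeConfig d L Circle) :
    wilsonLoop u1Rep x i j R T U = reChar (u1RectChar x i j R T) U := by
  simp [wilsonLoop, reChar]

/-- Every `U(1)` configuration is a square (edgewise square roots `e^{i arg/2}`). [folklore] -/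
theorem exists_mul_self_eq_u1Config (θ : GaugeConfig d L Circle) : ∃ ψ : GaugeConfig d L Circle, ψ * ψ = θ := by
  refine ⟨fun e => Circle.exp (Complex.arg (θ e : ℂ) / 2), funext fun e => ?_⟩
  rw [Pi.mul_apply, ← Circle.exp_add, add_halves, Circle.exp_arg]

end Characters

/-! ### The torus theory of `U(1)₄` as a Ginibre model -/

section Torus

/-- The interaction characters of the `U(1)` torus theory: one plaquette holonomy per torus
plaquette. [folklore] -/
def u1TorusChars (L : ℕ) (q : Plaquette 4 (L + 1)) : GaugeConfig 4 (L + 1) Circle →ₜ* Circle :=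
  u1PlaqChar q.1 q.2.1.1 q.2.1.2

/-- The Wilson weight of `U(1)` on the torus is Ginibre's weight for constant couplings `β`, up
to the constant `e^{-β |P|}`: `e^{-β ∑_q (1 − Re U_q)} = e^{-β|P|} e^{∑_q β Re U_q}`. [folklore] -/
theorem exp_neg_mul_wilsonAction_u1 (β : ℝ) (L : ℕ) (U : GaugeConfig 4 (L + 1) Circle) :
    Real.exp (-β * wilsonAction u1Rep U) =
      Real.exp (-β * Fintype.card (Plaquette 4 (L + 1))) *
        ginibreWeight (u1TorusChars L) (fun _ => β) U := by
  rw [ginibreWeight, ← Real.exp_add]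
  congr 1
  have h1 : wilsonAction u1Rep U = Fintype.card (Plaquette 4 (L + 1)) -
      ∑ q : Plaquette 4 (L + 1), ((plaquetteHolonomy U q.1 q.2.1.1 q.2.1.2 : Circle) : ℂ).re := by
    simp only [wilsonAction, trace_u1Rep_re, Nat.cast_one, Finset.sum_sub_distrib, Finset.sum_const,
      Finset.card_univ, nsmul_eq_mul, mul_one]
  have h2 : ginibreHamiltonian (u1TorusChars L) (fun _ => β) U =
      β * ∑ q : Plaquette 4 (L + 1), ((plaquetteHolonomy U q.1 q.2.1.1 q.2.1.2 : Circle) : ℂ).re := by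
    simp only [ginibreHamiltonian, reChar, u1TorusChars, u1PlaqChar_apply, ← Finset.mul_sum]
  rw [h1, h2]
  ring

/-- **The torus Wilson-loop expectation of `U(1)₄` is a Ginibre expectation** with constant
couplings `β`. [folklore] -/
theorem wilsonExpectation_u1_eq_ginibreExpect (β : ℝ) (L : ℕ) (i j : Fin 4) (R T : ℕ) :
    wilsonExpectation (L := L + 1) u1Rep β (wilsonLoop u1Rep (0 : Site 4 (L + 1)) i j R T) =
      ginibreExpect (Measure.pi fun _ : Edge 4 (L + 1) => haarProbability Circle)
        (u1TorusChars L) (fun _ => β) (reChar (u1RectChar (0 : Site 4 (L + 1)) i j R T)) := by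
  rw [wilsonExpectation_eq_div_integral u1Rep continuous_u1Rep, ginibreExpect]
  simp_rw [exp_neg_mul_wilsonAction_u1, wilsonLoop_u1Rep]
  set c := Real.exp (-β * Fintype.card (Plaquette 4 (L + 1)))
  have hc : c ≠ 0 := (Real.exp_pos _).ne'
  simp_rw [mul_left_comm _ c, integral_const_mul]
  rw [mul_div_mul_left _ _ hc]

end Torus

/-! ### The free-boundary cube theory of `U(1)₄` as a torus Ginibre model -/

section Box

/-- The torus plaquette below a plaquette label `(x, k, l)` of `ℤ⁴` (the pair `(k, l)` is
ordered for labels in `plaquettesIn Λ`; the `else` branch is a junk value never met there).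
[folklore] -/
def plaqToTorus (L : ℕ) (p : Plaq 4) : Plaquette 4 (L + 1) :=
  (Torus.proj (L + 1) p.1, if h : p.2.1 < p.2.2 then ⟨(p.2.1, p.2.2), h⟩ else ⟨(0, 1), by decide⟩)

/-- The switched-off couplings: `β` on the torus plaquettes below the plaquettes of the cube
`{-n,…,n}⁴`, `0` elsewhere. [folklore] -/
def boxCoupling (β : ℝ) (n L : ℕ) (q : Plaquette 4 (L + 1)) : ℝ :=
  if q ∈ (plaquettesIn (box 4 n)).image (plaqToTorus L) then β else 0

/-- `0 ≤ boxCoupling β n L q` for `β ≥ 0`. [folklore] -/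
theorem boxCoupling_nonneg {β : ℝ} (hβ : 0 ≤ β) (n L : ℕ) (q : Plaquette 4 (L + 1)) :
    0 ≤ boxCoupling β n L q := by
  unfold boxCoupling; split_ifs <;> [exact hβ; exact le_rfl]

/-- `boxCoupling β n L q ≤ β` for `β ≥ 0`. [folklore] -/
theorem boxCoupling_le {β : ℝ} (hβ : 0 ≤ β) (n L : ℕ) (q : Plaquette 4 (L + 1)) :
    boxCoupling β n L q ≤ β := by
  unfold boxCoupling; split_ifs <;> [exact le_rfl; exact hβ]

/-- `plaqToTorus` on a genuine plaquette label. [folklore] -/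
theorem plaqToTorus_of_lt (L : ℕ) {p : Plaq 4} (h : p.2.1 < p.2.2) :
    plaqToTorus L p = (Torus.proj (L + 1) p.1, ⟨(p.2.1, p.2.2), h⟩) := by
  simp [plaqToTorus, h]

/-- `plaqToTorus L` is injective on the plaquettes of the cube `{-n,…,n}⁴` when `2n ≤ L`.
[folklore] -/
theorem plaqToTorus_injOn {n L : ℕ} (hnL : 2 * n ≤ L) :
    Set.InjOn (plaqToTorus L) (plaquettesIn (box 4 n) : Set (Plaq 4)) := by
  intro p hp p' hp' h
  have hp1 := Plaq.mem_plaquettesIn.1 (Finset.mem_coe.1 hp)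
  have hp1' := Plaq.mem_plaquettesIn.1 (Finset.mem_coe.1 hp')
  rw [plaqToTorus_of_lt L hp1.2.1, plaqToTorus_of_lt L hp1'.2.1, Prod.mk.injEq] at h
  obtain ⟨h1, h2⟩ := h
  have h2' : (p.2.1, p.2.2) = (p'.2.1, p'.2.2) := congrArg Subtype.val h2
  refine Prod.ext (torusProj_succ_injOn_box hnL (Finset.mem_coe.2 hp1.1)
    (Finset.mem_coe.2 hp1'.1) h1) (Prod.ext ?_ ?_)
  · exact (Prod.mk.inj h2').1
  · exact (Prod.mk.inj h2').2

/-- The free-boundary cube action read on a periodic configuration is, up to the constant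
`|P(Λ_n)|`, minus the Ginibre Hamiltonian of the switched-off couplings (`2n ≤ L`). [folklore] -/
theorem neg_mul_zdWilsonAction_box_torusLift {n L : ℕ} (hnL : 2 * n ≤ L) (β : ℝ)
    (U : GaugeConfig 4 (L + 1) Circle) :
    -β * zdWilsonAction u1Rep (box 4 n) (torusLift (L + 1) U) =
      -β * #(plaquettesIn (box 4 n)) + ginibreHamiltonian (u1TorusChars L) (boxCoupling β n L) U := by
  rw [zdWilsonAction_torusLift]
  simp only [trace_u1Rep_re, Nat.cast_one, Finset.sum_sub_distrib, Finset.sum_const, nsmul_eq_mul,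
    mul_one]
  have hH : ginibreHamiltonian (u1TorusChars L) (boxCoupling β n L) U =
      β * ∑ p ∈ plaquettesIn (box 4 n),
        ((plaquetteHolonomy U (Torus.proj (L + 1) p.1) p.2.1 p.2.2 : Circle) : ℂ).re := by
    unfold ginibreHamiltonian boxCoupling
    simp only [ite_mul, zero_mul, Finset.sum_ite_mem, Finset.univ_inter]
    rw [Finset.sum_image fun p hp p' hp' h =>
      plaqToTorus_injOn hnL (Finset.mem_coe.2 hp) (Finset.mem_coe.2 hp') h, Finset.mul_sum]
    refine Finset.sum_congr rfl fun p hp => ?_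
    rw [plaqToTorus_of_lt L (Plaq.mem_plaquettesIn.1 hp).2.1]
    rfl
  rw [hH]
  ring

end Box

/-! ### The free-boundary cube expectation as a torus Ginibre expectation; the discharge -/

section Discharge

/-- `Torus.proj L 0 = 0`. [folklore] -/
theorem torusProj_zero (L d : ℕ) : Torus.proj L (0 : Literature.Probability.LatticeModels.Site d) = 0 := by
  funext i; simp [Torus.proj]

/-- **The free-boundary cube Wilson-loop expectation of `U(1)₄` is a torus Ginibre expectation
with the switched-off couplings** (`2n ≤ L`, loop at the origin in the `(i, j)` plane, `i ≠ j`,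
`R, T ≤ n`): both integrands depend only on cube edges (bonds of cube plaquettes and of the
loop), on which the periodisation `torusEdge (L+1)` is injective, so the transfer lemma turns
the `dg_∞`-integrals into torus Haar integrals, where the periodised observables are the torus
loop and `e^{-β|P|}` times the Ginibre weight of `boxCoupling`. [folklore] -/
theorem zdExpect_u1_box_eq_ginibreExpect {β : ℝ} {n L : ℕ} (hnL : 2 * n ≤ L) {i j : Fin 4}
    (hij : i ≠ j) {R T : ℕ} (hR : R ≤ n) (hT : T ≤ n) :
    zdExpect u1Rep β (box 4 n)
        (zdWilsonLoop u1Rep (0 : Literature.Probability.LatticeModels.Site 4) i j R T) =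
      ginibreExpect (Measure.pi fun _ : Edge 4 (L + 1) => haarProbability Circle)
        (u1TorusChars L) (boxCoupling β n L) (reChar (u1RectChar (0 : Site 4 (L + 1)) i j R T)) := by
  classical
  -- support of the integrands and injectivity of the periodisation on it
  set S : Finset (ZdEdge 4) := (plaquettesIn (box 4 n)).biUnion Plaq.bonds ∪
    loopEdges (0 : Literature.Probability.LatticeModels.Site 4) i j R T with hS
  have hSbox : ∀ e ∈ S, e.1 ∈ box 4 n := by
    intro e he
    rcases Finset.mem_union.1 he with he | he
    · obtain ⟨p, hp, hep⟩ := Finset.mem_biUnion.1 he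
      exact Plaq.fst_mem_of_mem_bonds hp hep
    · exact fst_mem_box_of_mem_loopEdges hij hR hT he
  have hinj : Set.InjOn (torusEdge (d := 4) (L + 1)) S := torusEdge_injOn hnL hSbox
  have hsub1 : ∀ e, e ∈ (loopEdges (0 : Literature.Probability.LatticeModels.Site 4) i j R T :
      Set (ZdEdge 4)) → e ∈ (S : Set (ZdEdge 4)) := fun e he =>
    Finset.mem_coe.2 (Finset.mem_union_right _ (Finset.mem_coe.1 he))
  have hsub2 : ∀ e, e ∈ (((plaquettesIn (box 4 n)).biUnion Plaq.bonds : Finset (ZdEdge 4)) :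
      Set (ZdEdge 4)) → e ∈ (S : Set (ZdEdge 4)) := fun e he =>
    Finset.mem_coe.2 (Finset.mem_union_left _ (Finset.mem_coe.1 he))
  -- continuity and dependence
  have hWc := continuous_zdWilsonLoop u1Rep continuous_u1Rep
    (0 : Literature.Probability.LatticeModels.Site 4) i j R T
  have hwc : Continuous fun U : ZdGaugeConfig 4 Circle =>
      Real.exp (-β * zdWilsonAction u1Rep (box 4 n) U) :=
    Real.continuous_exp.comp (continuous_const.mul (continuous_zdWilsonAction u1Rep continuous_u1Rep _))
  have hdepw : DependsOn (fun U : ZdGaugeConfig 4 Circle =>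
      Real.exp (-β * zdWilsonAction u1Rep (box 4 n) U)) (S : Set (ZdEdge 4)) := by
    intro U V h
    simp only
    rw [dependsOn_zdWilsonAction u1Rep (box 4 n) fun e he => h e (hsub2 e he)]
  have hdepWw : DependsOn (fun U : ZdGaugeConfig 4 Circle =>
      zdWilsonLoop u1Rep (0 : Literature.Probability.LatticeModels.Site 4) i j R T U *
        Real.exp (-β * zdWilsonAction u1Rep (box 4 n) U)) (S : Set (ZdEdge 4)) := by
    intro U V h
    simp only
    rw [dependsOn_zdWilsonLoop u1Rep _ i j R T fun e he => h e (hsub1 e he),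
      dependsOn_zdWilsonAction u1Rep (box 4 n) fun e he => h e (hsub2 e he)]
  -- transfer to the torus
  have t1 : ∫ U, zdWilsonLoop u1Rep (0 : Literature.Probability.LatticeModels.Site 4) i j R T U *
        Real.exp (-β * zdWilsonAction u1Rep (box 4 n) U) ∂zdHaar 4 Circle =
      ∫ U, zdWilsonLoop u1Rep (0 : Literature.Probability.LatticeModels.Site 4) i j R T
          (torusLift (L + 1) U) *
        Real.exp (-β * zdWilsonAction u1Rep (box 4 n) (torusLift (L + 1) U))
          ∂Measure.pi fun _ : Edge 4 (L + 1) => haarProbability Circle :=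
    (integral_torusLift_eq_integral_zdHaar hinj (hWc.mul hwc).measurable hdepWw).symm
  have t2 : ∫ U, Real.exp (-β * zdWilsonAction u1Rep (box 4 n) U) ∂zdHaar 4 Circle =
      ∫ U, Real.exp (-β * zdWilsonAction u1Rep (box 4 n) (torusLift (L + 1) U))
          ∂Measure.pi fun _ : Edge 4 (L + 1) => haarProbability Circle :=
    (integral_torusLift_eq_integral_zdHaar hinj hwc.measurable hdepw).symm
  rw [zdExpect_eq_div_integral u1Rep continuous_u1Rep, t1, t2, ginibreExpect]
  -- identify the periodised integrands
  have hw : ∀ U : GaugeConfig 4 (L + 1) Circle,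
      Real.exp (-β * zdWilsonAction u1Rep (box 4 n) (torusLift (L + 1) U)) =
        Real.exp (-β * #(plaquettesIn (box 4 n))) *
          ginibreWeight (u1TorusChars L) (boxCoupling β n L) U := fun U => by
    rw [neg_mul_zdWilsonAction_box_torusLift hnL, Real.exp_add, ginibreWeight]
  simp_rw [hw, zdWilsonLoop_torusLift, torusProj_zero, wilsonLoop_u1Rep]
  set c := Real.exp (-β * #(plaquettesIn (box 4 n)))
  have hc : c ≠ 0 := (Real.exp_pos _).ne'
  simp_rw [mul_left_comm _ c, integral_const_mul]
  rw [mul_div_mul_left _ _ hc]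

/-- **Discharge of `GinibreU1TorusGeFreeBoxD4` (Ginibre 1970).** For `β ≥ 0`, `2n ≤ L`, `i ≠ j`,
`R, T ≤ n`: `⟨W_{R×T}⟩^{free}_{Λ_n,β} ≤ ⟨W_{R×T}⟩_{torus L+1,β}` for Wilson-action `U(1)₄` — both
sides are Ginibre expectations of `Re χ_γ` on the torus configuration group
(`zdExpect_u1_box_eq_ginibreExpect`, `wilsonExpectation_u1_eq_ginibreExpect`) for the coupling
vectors `boxCoupling β n L ≤ β` (pointwise, both `≥ 0`), and Ginibre's inequality
`Literature.Probability.LatticeModels.ginibreExpect_reChar_mono` is monotonicity in the couplings.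
[cite: Ginibre1970, Prop. 3 with Example 4 (real parts of characters of a compact abelian group), as quoted by Forsström–Lenells–Viklund AIHP 2022 Lemma 4.2] -/
theorem GinibreU1TorusGeFreeBoxD4_holds : GinibreU1TorusGeFreeBoxD4 := by
  intro β hβ n L hnL i j R T hij hR hT
  rw [zdExpect_u1_box_eq_ginibreExpect hnL hij hR hT, wilsonExpectation_u1_eq_ginibreExpect]
  exact ginibreExpect_reChar_mono _ (fun θ => exists_mul_self_eq_u1Config θ) _ _
    (fun q => boxCoupling_nonneg hβ n L q) (fun q => boxCoupling_le hβ n L q)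

end Discharge

end Literature.MathematicalPhysics.QuantumFieldTheory
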